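import Mathlib
import Summits.MatrixMultiplication.MatrixMultiplication.Theses.MatrixPointInterpolation
import Summits.MatrixMultiplication.MatrixMultiplication.Theorems.MatrixPointInterpolationWindowedKaplanskyCapelli
import Summits.MatrixMultiplication.MatrixMultiplication.Theorems.MatrixPointInterpolationTightWindowsStubCoreThreeSlack

/-!
# Crux `TightWindows` (stmt-MatrixMultiplication-18939), line `shirshov-split` — `k = 3` core,
# RANK-ONE PENCIL locus (stub `stub_coreThreeRankOnePencil`)

The window-free Branch-II core at point size `3` holds — uniformly in the degree bound, with
`n₀ = 300` — whenever the affine pencil `span{1, A 0, A 1}` contains a rank-one matrix (the locus of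
the structured family on which the pencil identities survive longest: `A 0 =` shift, `A 1 = E_{1n}`,
identities exactly up to slot budget `n − 3`, generation length `2n − 2`).

Proof (`a = A 0`, `b = A 1 = u vᵀ`, `s_i = vᵀ aⁱ u`, `V_j = wordSpan A j`):
1. word count for a rank-one letter (`two_mul_sq_le_of_rankOne`): `2n² ≤ (d+1)(d+2)`, so with
   `n ≥ 300`, `L ≤ 19` the slot budget `E = d − 6L` is at least `n − 1`;
2. irreducibility (`invariant_eq_top`);
3. `c := ba − ab` has `c² = 0` ((P1) with both slots `b` at `Y = a` and `Y = a + b` makes `c²`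
   central, and `c` kills the joint kernel of `vᵀ`, `vᵀa`);
4. `s_0 = s_1 = 0`, then `s_m = s_{m+1} = 0 ⇒ s_{m+2} = 0` for `m + 2 ≤ E` ((P1) at `Y = a` with
   slots `b`, `aᵐ b`: after `key8` and the sandwich rule it reads
   `s_{m+1}(ba² − a²b) − s_{m+2}(ba − ab) − s_m(aba² − a²ba) = 0`); so `s_i = 0` for `i < n`, hence
   for all `i` (Cayley–Hamilton);
5. the joint kernel of the `vᵀ aⁱ` is a common invariant subspace containing `u ≠ 0`: contradiction.
Then the relabelling `coreThree_of_rankOne_gen` and the pencil change of letters give the stub.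
Stub-worker of the line's wave 6, 2026-08-17.
-/

set_option linter.dupNamespace false
-- `MatrixMultiplication.MatrixMultiplication` is the summit/sub-problem path (D-0017)

namespace Summit.MatrixMultiplication.MatrixMultiplication.Theorems.TightWindows

open scoped BigOperators
open Matrix Summit.MatrixMultiplication.MatrixMultiplication.Theorems.Masquerade

/-! ### The rank-one case of the open core -/

/-- **`stub_coreThree` in the rank-one degenerate case.**  The registered statement of
`stub_coreThree`, verbatim, under the single extra hypothesis `A 1 = Matrix.vecMulVec u v`
(a rank-one second generator): beyond `n₀ = 300` its hypotheses are contradictory.  See the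
module docstring for the proof (generation count `d ≥ n + 6L - 1`; `c = [b,a]` squares to `0`;
the moments `s_i = vᵀ a^i u` vanish for `i ≤ d - 6L` by identity (P1) at `Y = A 0` with slots
`A 1`, `(A 0)^m A 1`; hence for all `i`; the joint kernel of the `vᵀa^i` is a common invariant
subspace containing `u`). [folklore] -/
theorem coreThree_of_rankOne : ∀ C : ℕ, ∃ n₀ : ℕ, ∀ (n d L : ℕ) (A : Fin 2 → Matrix (Fin n) (Fin n) ℂ),
    n₀ ≤ n → d ≤ C * n → 1 ≤ L → L ≤ 19 →
    (∃ u v : Fin n → ℂ, A 1 = Matrix.vecMulVec u v) →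
    Submodule.span ℂ {M : Matrix (Fin n) (Fin n) ℂ |
      ∃ w : List (Fin 2), w.length ≤ d ∧ (w.map A).prod = M} = ⊤ →
    (∃ Y₀ ∈ Masquerade.wordSpan A L, LinearIndependent ℂ (fun j : Fin 4 => Y₀ ^ (j : ℕ))) →
    (∀ (e₁ e₂ : ℕ), 6 * L + d + e₁ + e₂ ≤ 2 * d → ∀ Y ∈ Masquerade.wordSpan A L,
      ∀ Z₁ ∈ Masquerade.wordSpan A e₁, ∀ Z₂ ∈ Masquerade.wordSpan A e₂,
      (Z₁ * Y - Y * Z₁) * (Z₂ * Y - Y * Z₂) * Y = Y * ((Z₁ * Y - Y * Z₁) * (Z₂ * Y - Y * Z₂)) ∧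
      (Z₁ * Y - Y * Z₁) * Y * (Z₂ * Y - Y * Z₂) * Y =
        Y * ((Z₁ * Y - Y * Z₁) * Y * (Z₂ * Y - Y * Z₂))) → False := by
  intro C
  refine ⟨300, fun n d L A hn _ hL1 hL19 hrk hspan _ hid => ?_⟩
  obtain ⟨u, v, hb⟩ := hrk
  obtain ⟨a, ha⟩ : ∃ a, A 0 = a := ⟨_, rfl⟩
  -- Step 1: the generation count gives `d ≥ n + 6L - 1`
  have hcount := two_mul_sq_le_of_rankOne ha hb hspan
  have hd : n + 6 * L ≤ d + 1 := by
    by_contra hcon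
    push Not at hcon
    have h1 : (d + 1) * (d + 2) ≤ (n + 113) * (n + 114) := Nat.mul_le_mul (by omega) (by omega)
    nlinarith
  -- the rank-one generator `b = u vᵀ`
  obtain ⟨b, hbb⟩ : ∃ b, vecMulVec u v = b := ⟨_, rfl⟩
  rw [hbb] at hb
  have hbv : ∀ y, b *ᵥ y = (v ⬝ᵥ y) • u := fun y => by
    rw [← hbb]; exact vecMulVec_mulVec_eq_smul u v y
  have hsand : ∀ X, b * X * b = (v ⬝ᵥ X *ᵥ u) • b := fun X => by
    rw [← hbb]; exact sandwich u v X
  -- the generators do not commute; `u, v ≠ 0`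
  have hcomm : a * b ≠ b * a := fun h =>
    LongMasqueradeNeg.false_of_commute (by omega) hspan (by rw [ha, hb]; exact h)
  have hu : u ≠ 0 := by
    rintro rfl
    exact hcomm (by rw [← hbb]; simp)
  have hv : v ≠ 0 := by
    rintro rfl
    exact hcomm (by rw [← hbb]; simp)
  -- memberships in the word filtration
  have haL : a ∈ wordSpan A L := ha ▸ gen_mem_wordSpan A hL1 0
  have hb1 : b ∈ wordSpan A 1 := hb ▸ gen_mem_wordSpan A le_rfl 1
  have hbL : b ∈ wordSpan A L := hb ▸ gen_mem_wordSpan A hL1 1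
  -- Step 3: `c = ba - ab` has scalar, hence zero, square
  have h11 := (hid 1 1 (by omega) a haL b hb1 b hb1).1
  have h11' := (hid 1 1 (by omega) (a + b) (Submodule.add_mem _ haL hbL) b hb1 b hb1).1
  have e1 : b * (a + b) - (a + b) * b = b * a - a * b := by noncomm_ring
  rw [e1] at h11'
  obtain ⟨c, hc⟩ : ∃ c, b * a - a * b = c := ⟨_, rfl⟩
  rw [hc] at h11 h11'
  have hcb : c * c * b = b * (c * c) := by
    rw [Matrix.mul_add, Matrix.add_mul, h11] at h11'
    exact add_left_cancel h11'
  obtain ⟨σ, hσ⟩ := LongMasqueradeNeg.scalar_of_commute_gens hspan (Z := c * c)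
    (Fin.forall_fin_two.2 ⟨by rw [ha]; exact h11, by rw [hb]; exact hcb⟩)
  -- a non-zero vector killed by the functionals `vᵀ` and `vᵀ a` (`n ≥ 3`)
  obtain ⟨x, hx0, hxv, hxva⟩ : ∃ x : Fin n → ℂ, x ≠ 0 ∧ v ⬝ᵥ x = 0 ∧ (v ᵥ* a) ⬝ᵥ x = 0 := by
    let Q : Matrix (Fin 2) (Fin n) ℂ := Matrix.of ![v, v ᵥ* a]
    have hker : LinearMap.ker (Matrix.mulVecLin Q) ≠ ⊥ := by
      apply LinearMap.ker_ne_bot_of_finrank_lt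
      simp only [Module.finrank_fintype_fun_eq_card, Fintype.card_fin]
      omega
    obtain ⟨z, hz, hz0⟩ := Submodule.exists_mem_ne_zero_of_ne_bot hker
    rw [LinearMap.mem_ker, Matrix.mulVecLin_apply] at hz
    have hq : ∀ j : Fin 2, (fun k => Q j k) ⬝ᵥ z = 0 := fun j => congrFun hz j
    exact ⟨z, hz0, by simpa [Q] using hq 0, by simpa [Q] using hq 1⟩
  have hcx : c *ᵥ x = 0 := by
    rw [← hc, Matrix.sub_mulVec, ← Matrix.mulVec_mulVec, ← Matrix.mulVec_mulVec, hbv, hbv, hxv,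
      zero_smul, Matrix.mulVec_zero, sub_zero, Matrix.dotProduct_mulVec, hxva, zero_smul]
  have hσ0 : σ = 0 := by
    have h : (c * c) *ᵥ x = 0 := by rw [← Matrix.mulVec_mulVec, hcx, Matrix.mulVec_zero]
    rw [hσ, Matrix.smul_mulVec, Matrix.one_mulVec, smul_eq_zero] at h
    exact h.resolve_right hx0
  have hcc : c * c = 0 := by rw [hσ, hσ0, zero_smul]
  -- Step 4: the base `vᵀ u = 0`, `vᵀ a u = 0`
  have hcu : c *ᵥ u = (v ⬝ᵥ (a *ᵥ u)) • u - (v ⬝ᵥ u) • (a *ᵥ u) := by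
    rw [← hc, Matrix.sub_mulVec, ← Matrix.mulVec_mulVec, ← Matrix.mulVec_mulVec, hbv, hbv,
      Matrix.mulVec_smul]
  have key : ∀ y, v ⬝ᵥ y = 0 →
      (v ⬝ᵥ (a *ᵥ y)) • ((v ⬝ᵥ (a *ᵥ u)) • u - (v ⬝ᵥ u) • (a *ᵥ u)) = 0 := by
    intro y hy
    have hcy : c *ᵥ y = (v ⬝ᵥ (a *ᵥ y)) • u := by
      rw [← hc, Matrix.sub_mulVec, ← Matrix.mulVec_mulVec, ← Matrix.mulVec_mulVec, hbv, hbv, hy,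
        zero_smul, Matrix.mulVec_zero, sub_zero]
    have h : (c * c) *ᵥ y = 0 := by rw [hcc, Matrix.zero_mulVec]
    rwa [← Matrix.mulVec_mulVec, hcy, Matrix.mulVec_smul, hcu] at h
  have hs01 : v ⬝ᵥ u = 0 ∧ v ⬝ᵥ (a *ᵥ u) = 0 := by
    by_cases hA : ∀ y, v ⬝ᵥ y = 0 → v ⬝ᵥ (a *ᵥ y) = 0
    · -- then `ker vᵀ` is a common invariant subspace: contradiction
      exfalso
      let Sv : Submodule ℂ (Fin n → ℂ) :=
        { carrier := {y | v ⬝ᵥ y = 0}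
          add_mem' := fun {y z} hy hz => by
            simp only [Set.mem_setOf_eq] at hy hz ⊢
            rw [dotProduct_add, hy, hz, add_zero]
          zero_mem' := by simp
          smul_mem' := fun r y hy => by
            simp only [Set.mem_setOf_eq] at hy ⊢
            rw [dotProduct_smul, hy, smul_zero] }
      have hinv : ∀ x' : Fin 2, ∀ y ∈ Sv, A x' *ᵥ y ∈ Sv := by
        refine Fin.forall_fin_two.2 ⟨fun y hy => ?_, fun y hy => ?_⟩
        · rw [ha]
          exact hA y hy
        · show v ⬝ᵥ (A 1 *ᵥ y) = 0
          rw [hb, hbv, (show v ⬝ᵥ y = 0 from hy), zero_smul, dotProduct_zero]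
      have htop := invariant_eq_top hspan Sv hinv (y := x) hxv hx0
      apply hv
      ext i
      have hi : (Pi.single i (1 : ℂ)) ∈ Sv := htop ▸ Submodule.mem_top
      have hi' : v ⬝ᵥ Pi.single i 1 = 0 := hi
      rwa [dotProduct_single_one] at hi'
    · push Not at hA
      obtain ⟨y, hy, hya⟩ := hA
      have h2 := key y hy
      rw [smul_eq_zero] at h2
      have h3 := h2.resolve_left hya
      by_cases hs0 : v ⬝ᵥ u = 0
      · rw [hs0, zero_smul, sub_zero, smul_eq_zero] at h3
        exact ⟨hs0, h3.resolve_right hu⟩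
      · -- then the line `ℂ u` is a common invariant subspace: contradiction
        exfalso
        have h3' := sub_eq_zero.1 h3
        have hau : a *ᵥ u = ((v ⬝ᵥ u)⁻¹ * (v ⬝ᵥ (a *ᵥ u))) • u := by
          rw [mul_smul, h3', smul_smul, inv_mul_cancel₀ hs0, one_smul]
        let Su : Submodule ℂ (Fin n → ℂ) := Submodule.span ℂ {u}
        have hinv : ∀ x' : Fin 2, ∀ y ∈ Su, A x' *ᵥ y ∈ Su := by
          refine Fin.forall_fin_two.2 ⟨fun y hy => ?_, fun y hy => ?_⟩
          · rw [ha]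
            obtain ⟨r, rfl⟩ := Submodule.mem_span_singleton.1 hy
            rw [Matrix.mulVec_smul, hau, smul_smul]
            exact Submodule.mem_span_singleton.2 ⟨_, rfl⟩
          · rw [hb, hbv]
            exact Submodule.mem_span_singleton.2 ⟨_, rfl⟩
        have htop := invariant_eq_top hspan Su hinv (Submodule.mem_span_singleton_self u) hu
        have h1 : Module.finrank ℂ Su ≤ 1 := by
          have := finrank_span_le_card (R := ℂ) ({u} : Set (Fin n → ℂ))
          simpa using this
        rw [htop, finrank_top, Module.finrank_fintype_fun_eq_card, Fintype.card_fin] at h1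
        omega
  -- Step 5: the moments `s_i = vᵀ a^i u` vanish for `i ≤ d - 6L`
  let s : ℕ → ℂ := fun i => v ⬝ᵥ (a ^ i *ᵥ u)
  have hstep : ∀ m : ℕ, m + 2 + 6 * L ≤ d → s m = 0 → s (m + 1) = 0 → s (m + 2) = 0 := by
    intro m hm hsm hsm1
    have hZ2 : a ^ m * b ∈ wordSpan A (m + 1) := by
      have := mul_mem_wordSpan (pow_mem_wordSpan (ha ▸ gen_mem_wordSpan A (le_refl 1) 0) m) hb1
      simpa using this
    have h := (hid 1 (m + 1) (by omega) a haL b hb1 (a ^ m * b) hZ2).1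
    have e := key8 a b (a ^ m)
    rw [sub_eq_zero.2 h, hsand (a ^ m), hsand (a * a ^ m), hsand (a * (a * a ^ m)),
      show a * a ^ m = a ^ (m + 1) from (pow_succ' a m).symm,
      show a * a ^ (m + 1) = a ^ (m + 2) from (pow_succ' a (m + 1)).symm,
      show v ⬝ᵥ (a ^ m *ᵥ u) = 0 from hsm, show v ⬝ᵥ (a ^ (m + 1) *ᵥ u) = 0 from hsm1] at e
    simp only [zero_smul, zero_mul, mul_zero, zero_sub, sub_zero, add_zero,
      smul_mul_assoc, mul_smul_comm] at e
    have e2 : (v ⬝ᵥ (a ^ (m + 2) *ᵥ u)) • (a * b - b * a) = 0 := by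
      rw [smul_sub, sub_eq_add_neg, add_comm]
      exact e.symm
    rcases smul_eq_zero.1 e2 with h0 | h0
    · exact h0
    · exact absurd (sub_eq_zero.1 h0) hcomm
  have hP : ∀ m : ℕ, m + 1 + 6 * L ≤ d → s m = 0 ∧ s (m + 1) = 0 := by
    intro m
    induction m with
    | zero =>
      intro _
      exact ⟨by simpa [s] using hs01.1, by simpa [s] using hs01.2⟩
    | succ m ih =>
      intro hm
      have h := ih (by omega)
      exact ⟨h.2, hstep m (by omega) h.1 h.2⟩
  have hsE : ∀ i : ℕ, i < n → s i = 0 := by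
    intro i hi
    rcases i with _ | i
    · exact (hP 0 (by omega)).1
    · exact (hP i (by omega)).2
  -- hence for all `i` (Cayley–Hamilton)
  have hsall : ∀ k : ℕ, s k = 0 := by
    intro k
    have hne : a.charpoly ≠ 1 := fun h => by
      have h' := congrArg Polynomial.natDegree h
      rw [Matrix.charpoly_natDegree_eq_dim, Fintype.card_fin, Polynomial.natDegree_one] at h'
      omega
    have hdeg : (Polynomial.X ^ k %ₘ a.charpoly).natDegree < n := by
      have h1 := Polynomial.natDegree_modByMonic_lt (Polynomial.X ^ k : Polynomial ℂ)
        a.charpoly_monic hne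
      rwa [Matrix.charpoly_natDegree_eq_dim, Fintype.card_fin] at h1
    show v ⬝ᵥ (a ^ k *ᵥ u) = 0
    rw [Matrix.pow_eq_aeval_mod_charpoly a k, Polynomial.aeval_eq_sum_range' hdeg,
      Matrix.sum_mulVec, dotProduct_sum]
    refine Finset.sum_eq_zero fun i hi => ?_
    rw [Matrix.smul_mulVec, dotProduct_smul,
      (show v ⬝ᵥ (a ^ i *ᵥ u) = 0 from hsE i (Finset.mem_range.1 hi)), smul_zero]
  -- Step 6: the joint kernel of the functionals `vᵀ a^i` is a common invariant subspace ∋ `u`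
  let S : Submodule ℂ (Fin n → ℂ) :=
    { carrier := {y | ∀ i : ℕ, v ⬝ᵥ (a ^ i *ᵥ y) = 0}
      add_mem' := fun {y z} hy hz i => by
        simp only [Set.mem_setOf_eq] at hy hz
        rw [Matrix.mulVec_add, dotProduct_add, hy i, hz i, add_zero]
      zero_mem' := fun i => by simp
      smul_mem' := fun r y hy i => by
        simp only [Set.mem_setOf_eq] at hy
        rw [Matrix.mulVec_smul, dotProduct_smul, hy i, smul_zero] }
  have hinv : ∀ x' : Fin 2, ∀ y ∈ S, A x' *ᵥ y ∈ S := by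
    refine Fin.forall_fin_two.2 ⟨fun y hy => ?_, fun y hy => ?_⟩
    · show ∀ i : ℕ, v ⬝ᵥ (a ^ i *ᵥ (A 0 *ᵥ y)) = 0
      intro i
      rw [ha, Matrix.mulVec_mulVec, ← pow_succ]
      exact hy (i + 1)
    · show ∀ i : ℕ, v ⬝ᵥ (a ^ i *ᵥ (A 1 *ᵥ y)) = 0
      intro i
      have hy0 : v ⬝ᵥ y = 0 := by simpa using hy 0
      rw [hb, hbv, hy0, zero_smul, Matrix.mulVec_zero, dotProduct_zero]
  have huS : u ∈ S := fun i => hsall i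
  have htop := invariant_eq_top hspan S hinv huS hu
  apply hv
  ext i
  have hi : (Pi.single i (1 : ℂ)) ∈ S := htop ▸ Submodule.mem_top
  have hi0 := hi 0
  rwa [pow_zero, Matrix.one_mulVec, dotProduct_single_one] at hi0

/-- **`stub_coreThree` when either generator has rank one.**  The registered statement of
`stub_coreThree`, verbatim, under the single extra hypothesis `∃ x u v, A x = Matrix.vecMulVec u v`;
reduced to `coreThree_of_rankOne` by relabelling the letters (`wordSpan_comp_swap`). [folklore] -/
theorem coreThree_of_rankOne_gen : ∀ C : ℕ, ∃ n₀ : ℕ, ∀ (n d L : ℕ) (A : Fin 2 → Matrix (Fin n) (Fin n) ℂ),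
    n₀ ≤ n → d ≤ C * n → 1 ≤ L → L ≤ 19 →
    (∃ (x : Fin 2) (u v : Fin n → ℂ), A x = Matrix.vecMulVec u v) →
    Submodule.span ℂ {M : Matrix (Fin n) (Fin n) ℂ |
      ∃ w : List (Fin 2), w.length ≤ d ∧ (w.map A).prod = M} = ⊤ →
    (∃ Y₀ ∈ Masquerade.wordSpan A L, LinearIndependent ℂ (fun j : Fin 4 => Y₀ ^ (j : ℕ))) →
    (∀ (e₁ e₂ : ℕ), 6 * L + d + e₁ + e₂ ≤ 2 * d → ∀ Y ∈ Masquerade.wordSpan A L,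
      ∀ Z₁ ∈ Masquerade.wordSpan A e₁, ∀ Z₂ ∈ Masquerade.wordSpan A e₂,
      (Z₁ * Y - Y * Z₁) * (Z₂ * Y - Y * Z₂) * Y = Y * ((Z₁ * Y - Y * Z₁) * (Z₂ * Y - Y * Z₂)) ∧
      (Z₁ * Y - Y * Z₁) * Y * (Z₂ * Y - Y * Z₂) * Y =
        Y * ((Z₁ * Y - Y * Z₁) * Y * (Z₂ * Y - Y * Z₂))) → False := by
  intro C
  obtain ⟨n₀, hn₀⟩ := coreThree_of_rankOne C
  refine ⟨n₀, fun n d L A hn hd hL1 hL19 ⟨x, u, v, hx⟩ hspan hex hid => ?_⟩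
  fin_cases x
  · -- relabel: `A' = A ∘ swap` has `A' 1 = A 0` of rank one
    let A' : Fin 2 → Matrix (Fin n) (Fin n) ℂ := A ∘ Equiv.swap (0 : Fin 2) 1
    have hsw : ∀ j, wordSpan A' j = wordSpan A j := wordSpan_comp_swap A
    have hspan' : Submodule.span ℂ {M : Matrix (Fin n) (Fin n) ℂ |
        ∃ w : List (Fin 2), w.length ≤ d ∧ (w.map A').prod = M} = ⊤ := by
      have h := hsw d
      simp only [wordSpan] at h
      rw [h]
      exact hspan
    refine hn₀ n d L A' hn hd hL1 hL19 ⟨u, v, by simpa [A'] using hx⟩ hspan' ?_ ?_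
    · simpa only [hsw] using hex
    · simpa only [hsw] using hid
  · exact hn₀ n d L A hn hd hL1 hL19 ⟨u, v, by simpa using hx⟩ hspan hex hid

/-- **`stub_coreThree` when the pencil `span{1, A 0, A 1}` contains a rank-one matrix.**  The
registered statement of `stub_coreThree`, verbatim, under the single extra hypothesis that some
`α·1 + β·A 0 + γ·A 1` with `(β, γ) ≠ (0, 0)` equals `Matrix.vecMulVec u v`.  All hypotheses of the
stub depend on `A` only through the affine pencil (the word filtration is unchanged under an affine
change of letters, `wordSpan_eq_of_gen_mem`), so this reduces to `coreThree_of_rankOne` for the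
letters `(A 0, u vᵀ)` (if `γ ≠ 0`) or `(A 1, u vᵀ)` (if `γ = 0 ≠ β`). [folklore] -/
theorem stub_coreThreeRankOnePencil : ∀ C : ℕ, ∃ n₀ : ℕ,
    ∀ (n d L : ℕ) (A : Fin 2 → Matrix (Fin n) (Fin n) ℂ),
    n₀ ≤ n → d ≤ C * n → 1 ≤ L → L ≤ 19 →
    (∃ (α β γ : ℂ) (u v : Fin n → ℂ), (β ≠ 0 ∨ γ ≠ 0) ∧
      α • (1 : Matrix (Fin n) (Fin n) ℂ) + β • A 0 + γ • A 1 = Matrix.vecMulVec u v) →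
    Submodule.span ℂ {M : Matrix (Fin n) (Fin n) ℂ |
      ∃ w : List (Fin 2), w.length ≤ d ∧ (w.map A).prod = M} = ⊤ →
    (∃ Y₀ ∈ Masquerade.wordSpan A L, LinearIndependent ℂ (fun j : Fin 4 => Y₀ ^ (j : ℕ))) →
    (∀ (e₁ e₂ : ℕ), 6 * L + d + e₁ + e₂ ≤ 2 * d → ∀ Y ∈ Masquerade.wordSpan A L,
      ∀ Z₁ ∈ Masquerade.wordSpan A e₁, ∀ Z₂ ∈ Masquerade.wordSpan A e₂,
      (Z₁ * Y - Y * Z₁) * (Z₂ * Y - Y * Z₂) * Y = Y * ((Z₁ * Y - Y * Z₁) * (Z₂ * Y - Y * Z₂)) ∧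
      (Z₁ * Y - Y * Z₁) * Y * (Z₂ * Y - Y * Z₂) * Y =
        Y * ((Z₁ * Y - Y * Z₁) * Y * (Z₂ * Y - Y * Z₂))) → False := by
  intro C
  obtain ⟨n₀, hn₀⟩ := coreThree_of_rankOne C
  refine ⟨n₀, fun n d L A hn hd hL1 hL19 ⟨α, β, γ, u, v, hβγ, hY⟩ hspan hex hid => ?_⟩
  -- the generators and `1` lie in `V_1`
  have h1 : (1 : Matrix (Fin n) (Fin n) ℂ) ∈ wordSpan A 1 := one_mem_wordSpan A 1
  have hA0 : A 0 ∈ wordSpan A 1 := gen_mem_wordSpan A le_rfl 0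
  have hA1 : A 1 ∈ wordSpan A 1 := gen_mem_wordSpan A le_rfl 1
  have hYmem : Matrix.vecMulVec u v ∈ wordSpan A 1 := by
    rw [← hY]
    exact Submodule.add_mem _ (Submodule.add_mem _ (Submodule.smul_mem _ _ h1)
      (Submodule.smul_mem _ _ hA0)) (Submodule.smul_mem _ _ hA1)
  -- the transfer of all hypotheses to new letters `A'` spanning the same pencil
  have transfer : ∀ A' : Fin 2 → Matrix (Fin n) (Fin n) ℂ, A' 1 = Matrix.vecMulVec u v →
      (∀ x : Fin 2, A' x ∈ wordSpan A 1) → (∀ x : Fin 2, A x ∈ wordSpan A' 1) → False := by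
    intro A' hA' h h'
    have heq : ∀ j, wordSpan A' j = wordSpan A j := wordSpan_eq_of_gen_mem h h'
    have hspan' : Submodule.span ℂ {M : Matrix (Fin n) (Fin n) ℂ |
        ∃ w : List (Fin 2), w.length ≤ d ∧ (w.map A').prod = M} = ⊤ := by
      have hj := heq d
      simp only [wordSpan] at hj
      rw [hj]
      exact hspan
    refine hn₀ n d L A' hn hd hL1 hL19 ⟨u, v, hA'⟩ hspan' ?_ ?_
    · simpa only [heq] using hex
    · simpa only [heq] using hid
  by_cases hγ : γ = 0
  · -- `γ = 0 ≠ β`: letters `(A 1, u vᵀ)`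
    have hβ : β ≠ 0 := hβγ.resolve_right (fun h => h hγ)
    refine transfer ![A 1, Matrix.vecMulVec u v] rfl
      (Fin.forall_fin_two.2 ⟨by simpa using hA1, by simpa using hYmem⟩)
      (Fin.forall_fin_two.2 ⟨?_, by simpa using gen_mem_wordSpan ![A 1, vecMulVec u v] le_rfl 0⟩)
    have h1' : (1 : Matrix (Fin n) (Fin n) ℂ) ∈ wordSpan ![A 1, vecMulVec u v] 1 :=
      one_mem_wordSpan _ 1
    have hY' : Matrix.vecMulVec u v ∈ wordSpan ![A 1, vecMulVec u v] 1 := by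
      simpa using gen_mem_wordSpan ![A 1, vecMulVec u v] le_rfl 1
    have e : A 0 = β⁻¹ • (Matrix.vecMulVec u v - α • (1 : Matrix (Fin n) (Fin n) ℂ)) := by
      rw [← hY, hγ, zero_smul, add_zero, add_sub_cancel_left, smul_smul, inv_mul_cancel₀ hβ,
        one_smul]
    rw [e]
    exact Submodule.smul_mem _ _ (Submodule.sub_mem _ hY' (Submodule.smul_mem _ _ h1'))
  · -- `γ ≠ 0`: letters `(A 0, u vᵀ)`
    refine transfer ![A 0, Matrix.vecMulVec u v] rfl
      (Fin.forall_fin_two.2 ⟨by simpa using hA0, by simpa using hYmem⟩)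
      (Fin.forall_fin_two.2 ⟨by simpa using gen_mem_wordSpan ![A 0, vecMulVec u v] le_rfl 0, ?_⟩)
    have h1' : (1 : Matrix (Fin n) (Fin n) ℂ) ∈ wordSpan ![A 0, vecMulVec u v] 1 :=
      one_mem_wordSpan _ 1
    have hA0' : A 0 ∈ wordSpan ![A 0, vecMulVec u v] 1 := by
      simpa using gen_mem_wordSpan ![A 0, vecMulVec u v] le_rfl 0
    have hY' : Matrix.vecMulVec u v ∈ wordSpan ![A 0, vecMulVec u v] 1 := by
      simpa using gen_mem_wordSpan ![A 0, vecMulVec u v] le_rfl 1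
    have e : A 1 = γ⁻¹ • (Matrix.vecMulVec u v - α • (1 : Matrix (Fin n) (Fin n) ℂ) - β • A 0) := by
      rw [← hY, show α • (1 : Matrix (Fin n) (Fin n) ℂ) + β • A 0 + γ • A 1 - α • 1 - β • A 0 =
        γ • A 1 by abel, smul_smul, inv_mul_cancel₀ hγ, one_smul]
    rw [e]
    exact Submodule.smul_mem _ _ (Submodule.sub_mem _ (Submodule.sub_mem _ hY'
      (Submodule.smul_mem _ _ h1')) (Submodule.smul_mem _ _ hA0'))

end Summit.MatrixMultiplication.MatrixMultiplication.Theorems.TightWindows
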